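import Literature.Probability.Percolation.TriAnnulusCrossingProofs
import Literature.Probability.Percolation.TriShiftedCrossings
import HarnessLib

/-!
# Chains of open circuits and open parallelogram crossings on `𝕋` (the RSW/FKG chaining construction)

Topic: Probability / Percolation. Triangular-lattice twin of `CrossingChains.lean` (the `ℤ²` bond
version): the *deterministic* part of the standard RSW/FKG chaining argument (Grimmett,
*Probability on Graphs*, 2nd ed. (2018), §5.7, PDF p. 176, "a standard application of the RSW
method": open circuits in overlapping annuli together with open long-way crossings of thin
parallelograms glue into one open cluster along a prescribed chain of centres), for site
percolation on the triangular lattice `𝕋 = triGraph`, in lattice coordinates. It is the engine of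
the lower bound of `Literature.Probability.Percolation.triCrossingProb_clusterPt_mem_Ioo`
(`BoxCrossing.lean`, crit-perc.S14; Kesten 1982, §3.4 for the RSW input).

* `triCircuitAt b v k` — a monochromatic circuit of colour `b` in the hexagonal annulus
  `5k ≤ |z - v|_𝕋 ≤ 7k` about the site `v` (the translate of `triHexCircuit b k` of
  `TriAnnulusCrossingProofs.lean`): increasing (for `b = true`), local, of `P_{1/2}`-probability
  that of `triHexCircuit b k` (hence `≥ c₀ > 0` for `k ≥ 1`, both colours,
  `exists_pos_le_real_triCircuitAt`), and — the property that replaces all planar topology in the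
  chaining — **every `𝕋`-walk from `|x - v|_𝕋 < 5k` to `|y - v|_𝕋 > 7k` meets the circuit**
  (`exists_circuit_of_mem_triCircuitAt`, by the crossing parity of `TriWalkParity.lean`).
* `exists_pathIn_coord_eq` — discrete intermediate values: a `𝕋`-path passes through every
  intermediate value of a coordinate (each step changes a coordinate by at most `1`).
* **the chaining construction** (`exists_pathIn_of_triChain`): centres `v 0, …, v N` moving by
  at most `m` per step in each coordinate, circuits of scale `m` about every centre and long-way
  (bottom–top) crossings of the parallelograms `[v_k₀, v_k₀ + m] × [v_k₁ - 9m, v_k₁ + 9m]`, all of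
  colour `b`, give a `𝕋`-path of colour-`b` sites from the circuit about `v 0` to every site of
  the circuit about `v N`, inside the *tube* `{z | ∃ k ≤ N, |z - v k|_𝕋 ≤ 10 m}` (`triTube`).

The probabilistic part (Harris–FKG, RSW bounds) and the planar-domain geometry are assembled in
`TriBoxCrossingLowerBound.lean`.

Mathlib anchors: `SimpleGraph.Walk` (`map`, `support`, `takeUntil`/`dropUntil` through
`PathIn.of_walk_mem_support`), `Relation.ReflTransGen` (head induction). Tree anchors:
`triHexCircuit`, `triHexAnnulus`, `determinedBy_triHexCircuit`, `exists_pos_le_real_triHexCircuit`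
(`TriAnnulusCrossingProofs.lean`), `windParity_eq_of_walk`, `exists_mem_support_of_windParity_ne`
(`TriWalkParity.lean`), `exists_walk_to_zero`, `windParity_eq_zero_of_triNorm_lt`, `triNorm_eq_max`
(`TriAnnulusCircuit.lean`), `triShiftIso` (`TriSubcriticalCrossing.lean`),
`pathIn_of_mem_shift_triTBCrossing`, `isUpperSet_preimage_relabel`, `determinedBy_preimage_relabel`
(`TriShiftedCrossings.lean`), `PathIn` (`SitePaths.lean`), `sitePercolation_real_preimage_relabel`
(`SitePercolationMeasure.lean`).

## References
* G. Grimmett, *Probability on Graphs*, 2nd ed., CUP (2018), §5.7 p. 176 (RSW chaining in a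
  domain), §5.5 (RSW on `𝕋`). [Grimmett2018]
* H. Kesten, *Percolation theory for mathematicians*, Birkhäuser (1982), §3.4. [KestenPTM1982]
* B. Bollobás, O. Riordan, *Percolation*, CUP (2006), Ch. 7, proof of Lemma 4 p. 167 (circuits in
  annuli of `𝕋`). [BollobasRiordan2006]
-/

noncomputable section

open MeasureTheory Set
open Literature.Probability.LatticeModels

namespace Literature.Probability.Percolation

/-! ### Monochromatic circuits about a site -/

/-- **A monochromatic circuit of scale `k` about the site `v`**: the translate by `v` of the event
`triHexCircuit b k` — a closed walk of `𝕋` of colour `b` in the hexagonal annulus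
`5k ≤ |z - v|_𝕋 ≤ 7k` with crossing parity `1` at `v` (Bollobás–Riordan 2006, proof of Lemma 4:
"a closed cycle in `δT` separating the inner and outer circles of the annulus").
[cite: BollobasRiordan2006, Ch. 7 proof of Lemma 4 p. 167] -/
def triCircuitAt (b : Bool) (v : Site 2) (k : ℕ) : Set (SiteConfig (Site 2)) :=
  SiteConfig.relabel (triShiftIso (-v)).toEquiv ⁻¹' triHexCircuit b k

/-- Membership in `triCircuitAt`, unfolded: the translated configuration `ω - v` has a circuit
about the origin. [folklore] -/
theorem mem_triCircuitAt_iff {b : Bool} {v : Site 2} {k : ℕ} {ω : SiteConfig (Site 2)} :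
    ω ∈ triCircuitAt b v k ↔ SiteConfig.relabel (triShiftIso (-v)).toEquiv ω ∈ triHexCircuit b k :=
  Iff.rfl

/-- A site `z` is coloured in the translated configuration `ω - v` as `z + v` is in `ω`.
[folklore] -/
theorem mem_relabel_triShiftIso_neg_iff (v : Site 2) (ω : SiteConfig (Site 2)) (z : Site 2) :
    z ∈ SiteConfig.relabel (triShiftIso (-v)).toEquiv ω ↔ z + v ∈ ω := by
  rw [SiteConfig.mem_relabel_iff]
  show (Site.shift (-v)).symm z ∈ ω ↔ _
  rw [Site.shift_symm_apply, sub_neg_eq_add]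

/-- **Translation invariance**: `P_{1/2}(triCircuitAt b v k) = P_{1/2}(triHexCircuit b k)`.
[folklore] -/
theorem triSitePercolation_real_triCircuitAt (p : unitInterval) (b : Bool) (v : Site 2) (k : ℕ) :
    (triSitePercolation p).real (triCircuitAt b v k) = (triSitePercolation p).real (triHexCircuit b k) := by
  rw [triCircuitAt, triSitePercolation, sitePercolation_real_preimage_relabel]

/-- **Circuits of both colours about every site**: there is `c₀ ∈ (0, 1)` with
`P_{1/2}(triCircuitAt b v k) ≥ c₀` for every site `v`, scale `k ≥ 1` and colour `b` (RSW on `𝕋`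
at aspect ratio `7`, Harris, colour symmetry: `exists_pos_le_real_triHexCircuit`).
[cite: BollobasRiordan2006, Ch. 7 proof of Lemma 4 p. 167] -/
theorem exists_pos_le_real_triCircuitAt :
    ∃ c₀ : ℝ, 0 < c₀ ∧ c₀ < 1 ∧ ∀ (b : Bool) (v : Site 2) (k : ℕ), 1 ≤ k →
      c₀ ≤ (triSitePercolation half).real (triCircuitAt b v k) := by
  obtain ⟨c₀, hc₀, hc₁, h⟩ := exists_pos_le_real_triHexCircuit
  exact ⟨c₀, hc₀, hc₁, fun b v k hk => by rw [triSitePercolation_real_triCircuitAt]; exact h b k hk⟩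

/-- Open circuits form an increasing event. [folklore] -/
theorem isUpperSet_triHexCircuit (k : ℕ) : IsUpperSet (triHexCircuit true k) := by
  rintro ω ω' hle ⟨v, w, hw, h1⟩
  refine ⟨v, w, fun z hz => ⟨?_, (hw z hz).2⟩, h1⟩
  have := (hw z hz).1
  simp only [iff_true] at this ⊢
  exact hle this

/-- Open circuits about a site form an increasing event. [folklore] -/
theorem isUpperSet_triCircuitAt (v : Site 2) (k : ℕ) : IsUpperSet (triCircuitAt true v k) :=
  isUpperSet_preimage_relabel _ (isUpperSet_triHexCircuit k)

/-- The circuit event about `v` is determined by the sites of the translated annulus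
`triHexAnnulus k + v`. [folklore] -/
theorem determinedBy_triCircuitAt (b : Bool) (v : Site 2) (k : ℕ) :
    DeterminedBy (triCircuitAt b v k) ↑((triHexAnnulus k).image fun z => z + v) := by
  have h := determinedBy_preimage_relabel (triShiftIso (-v)).toEquiv (determinedBy_triHexCircuit b k)
  unfold triCircuitAt
  convert h using 1
  ext z
  simp only [Finset.coe_image, Set.mem_image, Finset.mem_coe]
  constructor
  · rintro ⟨w, hw, rfl⟩
    exact ⟨w, hw, by simp [triShiftIso, Site.shift_symm_apply]⟩
  · rintro ⟨w, hw, hwz⟩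
    refine ⟨w, hw, ?_⟩
    rw [← hwz]
    simp [triShiftIso, Site.shift_symm_apply]

/-- The circuit event about a site is measurable (a cylinder event). [folklore] -/
theorem measurableSet_triCircuitAt (b : Bool) (v : Site 2) (k : ℕ) :
    MeasurableSet (triCircuitAt b v k) :=
  (determinedBy_triCircuitAt b v k).measurableSet_of_finset

/-- **The circuit about the origin meets every walk across its annulus**: a circuit of
`triHexCircuit b k` (parity `1` at the origin, sites in `5k ≤ |·|_𝕋 ≤ 7k`) shares a vertex with
every `𝕋`-walk from `|x|_𝕋 < 5k` to `|y|_𝕋 > 7k` (parity `1` at `x`, joined to `0` inside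
`|·|_𝕋 < 5k`; parity `0` at `y`). This is the combinatorial rendering of "a cycle separating the
inner and outer circles" (Bollobás–Riordan 2006, p. 167). [cite: BollobasRiordan2006, Ch. 7 proof of Lemma 4 p. 167] -/
theorem exists_mem_support_of_triHexCircuit_walk {k : ℕ} {c : Site 2} (w : triGraph.Walk c c)
    (hw : ∀ z ∈ w.support, (5 * k : ℤ) ≤ triNorm z ∧ triNorm z ≤ 7 * k) (h1 : windParity w 0 = 1)
    {x y : Site 2} (q : triGraph.Walk x y) (hx : triNorm x < 5 * k) (hy : (7 * k : ℤ) < triNorm y) :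
    ∃ z ∈ q.support, z ∈ w.support := by
  have hpx : windParity w x = 1 := by
    obtain ⟨q₀, hq₀⟩ := exists_walk_to_zero x
    rw [windParity_eq_of_walk w q₀ fun z hz hzw => ?_, h1]
    have := hq₀ z hz
    have := (hw z hzw).1
    omega
  have hpy : windParity w y = 0 :=
    windParity_eq_zero_of_triNorm_lt w (T := 7 * k) (fun z hz => by exact_mod_cast (hw z hz).2)
      (by exact_mod_cast hy)
  exact exists_mem_support_of_windParity_ne w (by rw [hpx, hpy]; decide) q

/-- **The circuit about `v`, as a walk, with its separating property.** On `triCircuitAt b v k`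
there is a closed walk of `𝕋` all of whose sites have colour `b` and lie in the annulus
`5k ≤ |z - v|_𝕋 ≤ 7k`, and which shares a vertex with every `𝕋`-walk from `|x - v|_𝕋 < 5k` to
`|y - v|_𝕋 > 7k`. [cite: BollobasRiordan2006, Ch. 7 proof of Lemma 4 p. 167] -/
theorem exists_circuit_of_mem_triCircuitAt {b : Bool} {v : Site 2} {k : ℕ} {ω : SiteConfig (Site 2)}
    (h : ω ∈ triCircuitAt b v k) :
    ∃ (c : Site 2) (w : triGraph.Walk c c),
      (∀ z ∈ w.support, (z ∈ ω ↔ b) ∧ (5 * k : ℤ) ≤ triNorm (z - v) ∧ triNorm (z - v) ≤ 7 * k) ∧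
      ∀ (x y : Site 2) (q : triGraph.Walk x y), triNorm (x - v) < 5 * k → (7 * k : ℤ) < triNorm (y - v) →
        ∃ z ∈ q.support, z ∈ w.support := by
  obtain ⟨c, w, hw, h1⟩ := mem_triCircuitAt_iff.1 h
  refine ⟨_, w.map (triShiftIso v).toHom, fun z hz => ?_, fun x y q hx hy => ?_⟩
  · rw [SimpleGraph.Walk.support_map, List.mem_map] at hz
    obtain ⟨u, hu, rfl⟩ := hz
    obtain ⟨hc, h5, h7⟩ := hw u hu
    rw [mem_relabel_triShiftIso_neg_iff] at hc
    refine ⟨?_, ?_, ?_⟩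
    · simpa [triShiftIso] using hc
    · simpa [triShiftIso] using h5
    · simpa [triShiftIso] using h7
  · obtain ⟨z, hzq, hzw⟩ := exists_mem_support_of_triHexCircuit_walk w (fun z hz => (hw z hz).2) h1
      (q.map (triShiftIso (-v)).toHom) (by simpa [triShiftIso, ← sub_eq_add_neg] using hx)
      (by simpa [triShiftIso, ← sub_eq_add_neg] using hy)
    rw [SimpleGraph.Walk.support_map, List.mem_map] at hzq
    obtain ⟨u, hu, rfl⟩ := hzq
    refine ⟨u, hu, ?_⟩
    rw [SimpleGraph.Walk.support_map, List.mem_map]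
    refine ⟨(triShiftIso (-v)).toHom u, hzw, ?_⟩
    simp [triShiftIso]

/-! ### Discrete intermediate values along `𝕋`-paths -/

/-- A step of `𝕋` changes each coordinate by at most `1`. [folklore] -/
theorem abs_sub_le_one_of_triGraph_adj {x y : Site 2} (h : triGraph.Adj x y) (i : Fin 2) :
    |y i - x i| ≤ 1 := by
  rw [abs_le]
  rcases triGraph_adj_cases h with h | h | h | h | h | h <;> fin_cases i <;> simp <;> omega

/-- **Discrete intermediate value theorem along a `𝕋`-path**: a path inside `A` from `u` to
`u'` passes through a site with any prescribed intermediate value `t` of the `i`-th coordinate,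
splitting there into two paths inside `A`. [folklore] -/
theorem exists_pathIn_coord_eq {A : Set (Site 2)} {u u' : Site 2} (h : PathIn triGraph A u u')
    (i : Fin 2) {t : ℤ} (hut : u i ≤ t) (htu' : t ≤ u' i) :
    ∃ z : Site 2, z i = t ∧ PathIn triGraph A u z ∧ PathIn triGraph A z u' := by
  obtain ⟨hu, hrel⟩ := h
  induction hrel using Relation.ReflTransGen.head_induction_on with
  | refl => exact ⟨u', le_antisymm hut htu', PathIn.refl hu, PathIn.refl hu⟩
  | @head a a' haa' hrel ih =>
    by_cases hat : a i = t
    · exact ⟨a, hat, PathIn.refl hu, ⟨hu, Relation.ReflTransGen.head haa' hrel⟩⟩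
    · have hlt : a i < t := lt_of_le_of_ne hut hat
      have hstep := abs_sub_le_one_of_triGraph_adj haa'.1 i
      have ha't : a' i ≤ t := by rw [abs_le] at hstep; omega
      obtain ⟨z, hz, h₁, h₂⟩ := ih ha't haa'.2
      exact ⟨z, hz, ⟨hu, Relation.ReflTransGen.head haa' h₁.2⟩, h₂⟩

/-! ### `triNorm` bookkeeping -/

/-- `|z|_𝕋 ≤ ρ` in terms of the three linear forms. [folklore] -/
theorem triNorm_le_iff_coord {z : Site 2} {ρ : ℤ} :
    triNorm z ≤ ρ ↔ |z 0| ≤ ρ ∧ |z 1| ≤ ρ ∧ |z 0 + z 1| ≤ ρ := by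
  simp only [triNorm, max_le_iff]

/-- `|z₁| ≤ |z|_𝕋`. [folklore] -/
theorem abs_apply_one_le_triNorm (z : Site 2) : |z 1| ≤ triNorm z :=
  (le_max_left _ _).trans (le_max_right _ _)

/-- `|z₀| ≤ |z|_𝕋`. [folklore] -/
theorem abs_apply_zero_le_triNorm (z : Site 2) : |z 0| ≤ triNorm z := le_max_left _ _

/-! ### The chain of circuits and crossings -/

/-- The **tube** of the chain: sites within `|·|_𝕋`-distance `10 m` of one of the centres
`v 0, …, v N`. [folklore] -/
def triTube (m : ℕ) (v : ℕ → Site 2) (N : ℕ) : Set (Site 2) :=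
  {z | ∃ k ≤ N, triNorm (z - v k) ≤ 10 * m}

/-- The tube grows with the chain. [folklore] -/
theorem triTube_mono {m : ℕ} {v : ℕ → Site 2} {N N' : ℕ} (h : N ≤ N') : triTube m v N ⊆ triTube m v N' :=
  fun _ ⟨k, hk, hz⟩ => ⟨k, hk.trans h, hz⟩

/-- The annulus of the circuit about `v k` lies in the tube. [folklore] -/
theorem mem_triTube_of_triNorm_le {m : ℕ} {v : ℕ → Site 2} {N k : ℕ} (hk : k ≤ N) {z : Site 2}
    (hz : triNorm (z - v k) ≤ 7 * m) : z ∈ triTube m v N :=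
  ⟨k, hk, hz.trans (by omega)⟩

/-- The **long parallelogram** at the centre `c`: `[c₀, c₀ + m] × [c₁ - 9m, c₁ + 9m]`, i.e. the
translate by `c - (0, 9m)` of `R(m, 18m)`; its open bottom–top crossing is the event
`SiteConfig.relabel (triShiftIso (-(c - (0, 9m)))) ⁻¹' triTBCrossing m (18 m)`. [folklore] -/
def triChainCorner (m : ℕ) (c : Site 2) : Site 2 := c - ![0, (9 * m : ℤ)]

/-- Coordinates of the corner. [folklore] -/
@[simp] theorem triChainCorner_apply_zero (m : ℕ) (c : Site 2) : triChainCorner m c 0 = c 0 := by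
  simp [triChainCorner]

/-- Coordinates of the corner. [folklore] -/
@[simp] theorem triChainCorner_apply_one (m : ℕ) (c : Site 2) : triChainCorner m c 1 = c 1 - 9 * m := by
  simp [triChainCorner]

/-- Sites of the long parallelogram at `c` are within `|·|_𝕋`-distance `10 m` of `c`. [folklore] -/
theorem triNorm_sub_le_of_mem_parallelogram {m : ℕ} {c z : Site 2}
    (hz : triChainCorner m c 0 ≤ z 0 ∧ z 0 ≤ triChainCorner m c 0 + m ∧
      triChainCorner m c 1 ≤ z 1 ∧ z 1 ≤ triChainCorner m c 1 + (18 * m : ℕ)) :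
    triNorm (z - c) ≤ 10 * m := by
  simp only [triChainCorner_apply_zero, triChainCorner_apply_one] at hz
  push_cast at hz
  rw [triNorm_le_iff_coord]
  simp only [Pi.sub_apply, abs_le]
  omega

/-- **Induction step of the chaining construction** (Grimmett 2018, §5.7): the open bottom–top
crossing of the long parallelogram at `v N` passes through a site at `|·|_𝕋`-distance `< 5m` from
both `v N` and `v (N+1)` (a site on the row of `v N`; the centres differ by at most `m` in each
coordinate) and ends farther than `7m` from both, so it meets the circuit about `v N` and the
circuit about `v (N+1)`; hence every site of the new circuit is joined to the base site through
colour-`b` sites of the enlarged tube. [cite: Grimmett2018, §5.7 p. 176] -/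
theorem pathIn_triTube_succ {b : Bool} {ω : SiteConfig (Site 2)} {m : ℕ} (hm : 1 ≤ m)
    {v : ℕ → Site 2} {N : ℕ} {x₀ : Site 2}
    {cN : Site 2} {wN : triGraph.Walk cN cN}
    (hsepN : ∀ (x y : Site 2) (q : triGraph.Walk x y), triNorm (x - v N) < 5 * m →
      (7 * m : ℤ) < triNorm (y - v N) → ∃ z ∈ q.support, z ∈ wN.support)
    {cN' : Site 2} {wN' : triGraph.Walk cN' cN'}
    (hwN' : ∀ z ∈ wN'.support, (z ∈ ω ↔ b) ∧ (5 * m : ℤ) ≤ triNorm (z - v (N + 1)) ∧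
      triNorm (z - v (N + 1)) ≤ 7 * m)
    (hsepN' : ∀ (x y : Site 2) (q : triGraph.Walk x y), triNorm (x - v (N + 1)) < 5 * m →
      (7 * m : ℤ) < triNorm (y - v (N + 1)) → ∃ z ∈ q.support, z ∈ wN'.support)
    (hIH : ∀ y ∈ wN.support, PathIn triGraph ({z | (z ∈ ω ↔ b)} ∩ triTube m v N) x₀ y)
    (hv0 : |v (N + 1) 0 - v N 0| ≤ m) (hv1 : |v (N + 1) 1 - v N 1| ≤ m)
    {u u' : Site 2} (hu : u 1 = triChainCorner m (v N) 1) (hu' : u' 1 = triChainCorner m (v N) 1 + (18 * m : ℕ))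
    (hT : PathIn triGraph ({z | (z ∈ ω ↔ b)} ∩ {z | triChainCorner m (v N) 0 ≤ z 0 ∧
      z 0 ≤ triChainCorner m (v N) 0 + m ∧ triChainCorner m (v N) 1 ≤ z 1 ∧
      z 1 ≤ triChainCorner m (v N) 1 + (18 * m : ℕ)}) u u') :
    ∀ y ∈ wN'.support, PathIn triGraph ({z | (z ∈ ω ↔ b)} ∩ triTube m v (N + 1)) x₀ y := by
  classical
  -- the box of the crossing lies in the tube of `v N`
  set Box : Set (Site 2) := {z | triChainCorner m (v N) 0 ≤ z 0 ∧
      z 0 ≤ triChainCorner m (v N) 0 + m ∧ triChainCorner m (v N) 1 ≤ z 1 ∧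
      z 1 ≤ triChainCorner m (v N) 1 + (18 * m : ℕ)} with hBox
  have hBoxTube : {z | (z ∈ ω ↔ b)} ∩ Box ⊆ {z | (z ∈ ω ↔ b)} ∩ triTube m v (N + 1) :=
    fun z hz => ⟨hz.1, N, N.le_succ, triNorm_sub_le_of_mem_parallelogram hz.2⟩
  -- a site of the crossing on the row of `v N`
  have hu1 : u 1 ≤ v N 1 := by rw [hu, triChainCorner_apply_one]; omega
  have hu'1 : v N 1 ≤ u' 1 := by rw [hu', triChainCorner_apply_one]; push_cast; omega
  obtain ⟨z, hz1, -, hzu'⟩ := exists_pathIn_coord_eq hT 1 hu1 hu'1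
  obtain ⟨q, hq⟩ := hzu'.exists_walk
  have hzBox : z ∈ Box := (hzu'.left_mem).2
  have hu'Box : u' ∈ Box := (hzu'.right_mem).2
  simp only [hBox, mem_setOf_eq, triChainCorner_apply_zero, triChainCorner_apply_one] at hzBox hu'Box
  push_cast at hzBox hu'Box hu'
  -- distances from `v N` and `v (N+1)`
  have hm' : (1 : ℤ) ≤ m := by exact_mod_cast hm
  have hv0' := abs_le.1 hv0
  have hv1' := abs_le.1 hv1
  have hzN : triNorm (z - v N) < 5 * m := by
    have : triNorm (z - v N) ≤ m := by
      rw [triNorm_le_iff_coord]; simp only [Pi.sub_apply, abs_le]; omega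
    omega
  have hzN' : triNorm (z - v (N + 1)) < 5 * m := by
    have : triNorm (z - v (N + 1)) ≤ 3 * m := by
      rw [triNorm_le_iff_coord]; simp only [Pi.sub_apply, abs_le]; omega
    omega
  have hu'N : (7 * m : ℤ) < triNorm (u' - v N) := by
    have h := abs_apply_one_le_triNorm (u' - v N)
    simp only [Pi.sub_apply] at h
    rw [triChainCorner_apply_one] at hu'
    have : (9 * m : ℤ) ≤ |u' 1 - v N 1| := by rw [le_abs]; left; omega
    omega
  have hu'N' : (7 * m : ℤ) < triNorm (u' - v (N + 1)) := by
    have h := abs_apply_one_le_triNorm (u' - v (N + 1))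
    simp only [Pi.sub_apply] at h
    rw [triChainCorner_apply_one] at hu'
    have : (8 * m : ℤ) ≤ |u' 1 - v (N + 1) 1| := by rw [le_abs]; left; omega
    omega
  -- the crossing meets both circuits
  obtain ⟨c₁, hc₁q, hc₁w⟩ := hsepN z u' q hzN hu'N
  obtain ⟨c₂, hc₂q, hc₂w⟩ := hsepN' z u' q hzN' hu'N'
  -- paths: base → c₁ (IH), c₁ → c₂ (along the crossing), c₂ → y (along the new circuit)
  have h₁ : PathIn triGraph ({z | (z ∈ ω ↔ b)} ∩ triTube m v (N + 1)) x₀ c₁ :=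
    (hIH c₁ hc₁w).mono (inter_subset_inter_right _ (triTube_mono N.le_succ))
  have h₂ : PathIn triGraph ({z | (z ∈ ω ↔ b)} ∩ triTube m v (N + 1)) c₁ c₂ := by
    have hq₁ := (PathIn.of_walk_mem_support q hq hc₁q).1
    have hq₂ := (PathIn.of_walk_mem_support q hq hc₂q).1
    exact (hq₁.symm.trans hq₂).mono hBoxTube
  have hwN'A : ∀ z ∈ wN'.support, z ∈ {z | (z ∈ ω ↔ b)} ∩ triTube m v (N + 1) := fun z hz =>
    ⟨(hwN' z hz).1, mem_triTube_of_triNorm_le le_rfl (hwN' z hz).2.2⟩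
  intro y hy
  have h₃ : PathIn triGraph ({z | (z ∈ ω ↔ b)} ∩ triTube m v (N + 1)) c₂ y :=
    (PathIn.of_walk_mem_support wN' hwN'A hc₂w).1.symm.trans (PathIn.of_walk_mem_support wN' hwN'A hy).1
  exact (h₁.trans h₂).trans h₃

/-- **The chaining construction on `𝕋`** (Grimmett 2018, §5.7; the triangular twin of
`exists_chainCluster`). Let `m ≥ 1`, let the centres `v k` move by at most `m` per step in each
coordinate, and let a site configuration `ω` contain, for every `k ≤ N`, a closed walk `w k` of
colour `b` in the annulus `5m ≤ |· - v k|_𝕋 ≤ 7m` meeting every `𝕋`-walk across that annulus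
(the witnesses of `triCircuitAt b (v k) m`), and, for every `k < N`, a colour-`b` bottom–top
crossing of the long parallelogram `[v_k₀, v_k₀ + m] × [v_k₁ - 9m, v_k₁ + 9m]`. Then every site of
the last circuit `w N` is joined to the base site of the first circuit `w 0` by a `𝕋`-path of
colour-`b` sites inside the tube `triTube m v N`. [cite: Grimmett2018, §5.7 p. 176] -/
theorem exists_pathIn_of_triChain {b : Bool} {ω : SiteConfig (Site 2)} {m : ℕ} (hm : 1 ≤ m)
    (v : ℕ → Site 2) (c : ℕ → Site 2) (w : ∀ k, triGraph.Walk (c k) (c k)) :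
    ∀ N : ℕ, (∀ k < N, |v (k + 1) 0 - v k 0| ≤ m ∧ |v (k + 1) 1 - v k 1| ≤ m) →
      (∀ k ≤ N, (∀ z ∈ (w k).support, (z ∈ ω ↔ b) ∧ (5 * m : ℤ) ≤ triNorm (z - v k) ∧
        triNorm (z - v k) ≤ 7 * m) ∧
        ∀ (x y : Site 2) (q : triGraph.Walk x y), triNorm (x - v k) < 5 * m →
          (7 * m : ℤ) < triNorm (y - v k) → ∃ z ∈ q.support, z ∈ (w k).support) →
      (∀ k < N, ∃ u u' : Site 2, u 1 = triChainCorner m (v k) 1 ∧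
        u' 1 = triChainCorner m (v k) 1 + (18 * m : ℕ) ∧
        PathIn triGraph ({z | (z ∈ ω ↔ b)} ∩ {z | triChainCorner m (v k) 0 ≤ z 0 ∧
          z 0 ≤ triChainCorner m (v k) 0 + m ∧ triChainCorner m (v k) 1 ≤ z 1 ∧
          z 1 ≤ triChainCorner m (v k) 1 + (18 * m : ℕ)}) u u') →
      ∀ y ∈ (w N).support, PathIn triGraph ({z | (z ∈ ω ↔ b)} ∩ triTube m v N) (c 0) y
  | 0, _, hw, _ => by
    classical
    intro y hy
    have hwA : ∀ z ∈ (w 0).support, z ∈ {z | (z ∈ ω ↔ b)} ∩ triTube m v 0 := fun z hz =>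
      ⟨((hw 0 le_rfl).1 z hz).1, mem_triTube_of_triNorm_le le_rfl ((hw 0 le_rfl).1 z hz).2.2⟩
    exact (PathIn.of_walk_mem_support (w 0) hwA hy).1
  | N + 1, hv, hw, hX => by
    have hIH := exists_pathIn_of_triChain hm v c w N (fun k hk => hv k (Nat.lt_succ_of_lt hk))
      (fun k hk => hw k (Nat.le_succ_of_le hk)) (fun k hk => hX k (Nat.lt_succ_of_lt hk))
    obtain ⟨u, u', hu, hu', hT⟩ := hX N (Nat.lt_succ_self N)
    exact pathIn_triTube_succ hm (hw N N.le_succ).2 (hw (N + 1) le_rfl).1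
      (hw (N + 1) le_rfl).2 hIH (hv N (Nat.lt_succ_self N)).1 (hv N (Nat.lt_succ_self N)).2 hu hu' hT

/-- **The crossing hypothesis from the crossing events.** On the translated crossing event
`relabel (triShiftIso (-(triChainCorner m c))) ⁻¹' TB(m, 18m)` the configuration contains an
open bottom–top crossing of the long parallelogram at `c`, in coordinates
(`pathIn_of_mem_shift_triTBCrossing`). [folklore] -/
theorem exists_pathIn_of_mem_shift_triTBCrossing_corner {m : ℕ} {c : Site 2} {ω : SiteConfig (Site 2)}
    (h : ω ∈ SiteConfig.relabel (triShiftIso (-triChainCorner m c)).toEquiv ⁻¹' triTBCrossing m (18 * m)) :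
    ∃ u u' : Site 2, u 1 = triChainCorner m c 1 ∧ u' 1 = triChainCorner m c 1 + (18 * m : ℕ) ∧
      PathIn triGraph ({z | (z ∈ ω ↔ true)} ∩ {z | triChainCorner m c 0 ≤ z 0 ∧
        z 0 ≤ triChainCorner m c 0 + m ∧ triChainCorner m c 1 ≤ z 1 ∧
        z 1 ≤ triChainCorner m c 1 + (18 * m : ℕ)}) u u' := by
  obtain ⟨u, u', hu, hu', hP⟩ := pathIn_of_mem_shift_triTBCrossing h
  refine ⟨u, u', hu, hu', hP.mono fun z hz => ⟨?_, hz.2⟩⟩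
  simpa using hz.1

end Literature.Probability.Percolation
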